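import Literature.Probability.FitznerVanDerHofstad2017.SawCountD11Link
import Literature.Probability.FitznerVanDerHofstad2017.SawCountTablesGN12X1111y
import Literature.Probability.FitznerVanDerHofstad2017.SawCountTablesGN12X112w
import Literature.Probability.FitznerVanDerHofstad2017.TrailCountTablesD11V2
import Literature.Probability.FitznerVanDerHofstad2017.PosExprEval
import Literature.Probability.FitznerVanDerHofstad2017.Stage1CellsU
import Literature.Probability.FitznerVanDerHofstad2017.MeanFieldD11Stage1Tabs13
import HarnessLib
import Summits.CriticalPhenomena.LaceExpansionHighD.SawReadKeysCells

/-!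
# Walk-count read keys of the record `d = 11` stage-1 evaluation — PART B census + headline, PART C (`nrBAW`)

Kernel CENSUS `cellsAt_read` / `cellsAt13_read` (every `.saw j v` key read by any of the 610 typed cells at `(11,12,28)` /
`(11,13,28)` lies in `sawReadKeys13`) with controls, the congruence `evalQ_congr_of_sawRead`, the HEADLINE `evalQ_withTrueSaw`
(+ `…13`, `…_tabsHi`, `eval_withTrueSaw`); PART C: `bawKeyRead` / `bawReadKeys`, census `cellsAt_bawRead` / `cellsAt13_bawRead`,
`baw_read_certified12` / `baw_read_certified13` (the ONE residual `nrBAW[13,11,{1}] = 1475645364480` enters only as the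
hypothesis `hres` of `evalQ_withTrueBaw13`, discharged by `TrailCountN13X1.bawRows_v1_getD_13_eq_card`), `evalQ_withTrueBaw`,
`evalQ_withTrueWalkCounts_tabsHi`, `eval_withTrueBaw13_le`.  See `SawReadKeysA` for the whole statement.  LAYOUT (enum1-g12, four modules of `≤ 390` lines, bodies verbatim from enum1-g11 rev 3, chained by sibling imports):
`SawReadKeysA` (PART A) → `SawReadKeysPX` (PART B, generic `PXKeys` lemmas + glue) → `SawReadKeysCells` (PART B, the generated
cell lists `cellsAt`) → `SawReadKeys` (PART B census + headline, PART C).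
-/

namespace Summit.CriticalPhenomena.LaceExpansionHighD

open Literature.Probability.FitznerVanDerHofstad2017 Literature.Probability.Percolation
open Literature.Probability.FitznerVanDerHofstad2017.Stage1Cells (V)
open Stage1Cells

/-- bookkeeping: 610 terms. -/
theorem length_cellsAt : (cellsAt CertD11.P).length = 610 := by decide +kernel

/-- THE CENSUS at the record parameters `(d, ComputedSteps, MaxNumberOfSteps) = (11, 12, 28)`: every `nrSAW` key read by
any cell is in the read set. -/
theorem cellsAt_read : (cellsAt CertD11.P).all (PXKeys.allTabs sawKeyRead) = true := by decide +kernel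

/-- THE CENSUS at `(11, 13, 28)` (the `U13` record variant; `E = 2⌊13/2⌋ = 12` again, so the reads coincide). -/
theorem cellsAt13_read : (cellsAt CertD11CS13.P13).all (PXKeys.allTabs sawKeyRead) = true := by decide +kernel

/-- Control (the census is not vacuous): dropping `(13, e₁)` from the test fails it — cell 9 (`Gmax1`) reads `nrSAW[13,d,{1}]`. -/
theorem cellsAt_read_needs13 :
    (cellsAt CertD11.P).all (PXKeys.allTabs fun k => match k with
      | .saw j v => decide (1 ≤ j) && decide (j ≤ 12) && !decide (v = .v0)
      | _ => true) = false := by decide +kernel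

/-- Control: `(12, (1,1,1,1))` IS read (by the record variant's `Rec.piece 4`; the port alone does not read it). -/
theorem cellsAt_read_needs12v4 :
    (cellsAt CertD11.P).all (PXKeys.allTabs fun k => match k with
      | .saw j v => sawKeyRead (.saw j v) && !(decide (j = 12) && decide (v = .v4))
      | _ => true) = false ∧
    (portT CertD11.P ++ extraT CertD11.P ++ (portVec CertD11.P).flatMap vecL ++ (portMat CertD11.P).flatMap matL).all
      (PXKeys.allTabs fun k => match k with
      | .saw j v => sawKeyRead (.saw j v) && !(decide (j = 12) && decide (v = .v4))
      | _ => true) = true := by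
  constructor <;> decide +kernel

/-! ### Congruence: cells do not see the `nrSAW` column off the read set -/

/-- two rational table records that agree off the `nrSAW` column and ON THE READ SET of the `nrSAW` column give every
cell of a censused parameter set the same rational value (any atom valuation). -/
theorem evalQ_congr_of_sawRead {P : Params} (hP : (cellsAt P).all (PXKeys.allTabs sawKeyRead) = true)
    {t t' : TabsQ} (hI : t.I = t'.I) (hK : t.K = t'.K) (hbaw : t.baw = t'.baw)
    (hsaw : ∀ j v, (j, v) ∈ sawReadKeys13 → t.saw j v = t'.saw j v) (va : Atom → ℚ) :
    ∀ c ∈ cellsAt P, PX.evalQ va (t.val 11) c = PX.evalQ va (t'.val 11) c := by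
  rw [List.all_eq_true] at hP
  have h62 : (6, V.v2) ∈ sawReadKeys13 := by decide
  have h42 : (4, V.v2) ∈ sawReadKeys13 := by decide
  have h601 : (6, V.v01) ∈ sawReadKeys13 := by decide
  have hk : ∀ k, sawKeyRead k = true → t.val 11 k = t'.val 11 k := by
    intro k hk
    cases k with
    | I n l v => simp only [TabsQ.val, hI]
    | K n l v => simp only [TabsQ.val, hK]
    | saw j v => exact hsaw j v ((sawKeyRead_saw_iff j v).1 hk)
    | baw j v => simp only [TabsQ.val, hbaw]
    | sawIk6 => simp only [TabsQ.val, hsaw 6 .v2 h62]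
    | sawIk4 => simp only [TabsQ.val, hsaw 4 .v2 h42]
    | sawTwoi6 => simp only [TabsQ.val, hsaw 6 .v01 h601]
  intro c hc
  exact PXKeys.evalQ_congr hk c (hP c hc)

/-- the same for REAL table records (`Stage1Frame.Tabs`) and the real semantics `PX.eval`. -/
theorem eval_congr_of_sawRead {P : Params} (hP : (cellsAt P).all (PXKeys.allTabs sawKeyRead) = true)
    {τ τ' : Tabs} (hI : τ.I = τ'.I) (hK : τ.K = τ'.K) (hbaw : τ.baw = τ'.baw)
    (hsaw : ∀ j v, (j, v) ∈ sawReadKeys13 → τ.saw j v = τ'.saw j v) (va : Atom → ℝ) :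
    ∀ c ∈ cellsAt P, PX.eval va (τ.val 11) c = PX.eval va (τ'.val 11) c := by
  rw [List.all_eq_true] at hP
  have h62 : (6, V.v2) ∈ sawReadKeys13 := by decide
  have h42 : (4, V.v2) ∈ sawReadKeys13 := by decide
  have h601 : (6, V.v01) ∈ sawReadKeys13 := by decide
  have hk : ∀ k, sawKeyRead k = true → τ.val 11 k = τ'.val 11 k := by
    intro k hk
    cases k with
    | I n l v => simp only [Tabs.val, hI]
    | K n l v => simp only [Tabs.val, hK]
    | saw j v => exact hsaw j v ((sawKeyRead_saw_iff j v).1 hk)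
    | baw j v => simp only [Tabs.val, hbaw]
    | sawIk6 => simp only [Tabs.val, hsaw 6 .v2 h62]
    | sawIk4 => simp only [Tabs.val, hsaw 4 .v2 h42]
    | sawTwoi6 => simp only [Tabs.val, hsaw 6 .v01 h601]
  intro c hc
  exact PXKeys.eval_congr hk c (hP c hc)

/-! ### The headline: the true `nrSAW` column is interchangeable with the recorded one -/

/-- a rational table record with its ENTIRE `nrSAW` column replaced by the true endpoint counts
`#sawWordsTo 11 j x_v` (every `j`, every class; origin class at the origin). -/
noncomputable def withTrueSaw (t : TabsQ) : TabsQ :=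
  { t with saw := fun j v => ((sawWordsTo 11 j (siteOfList (sawProfile v) 11)).card : ℚ) }

/-- HEADLINE (rational semantics).  For any table record whose `nrSAW` column is the recorded `CertD11.sawRows`
(`tabsHi`, `tabsLo`, `tabsHi13`, `tabsLo13` all are, by `rfl`): substituting the TRUE counts for the whole column changes
the value of no stage-1 cell at the record parameters — because the cells read the column only on `sawReadKeys13`
(`cellsAt_read`) and there the recorded entries ARE the true counts (`saw_read_certified`). -/
theorem evalQ_withTrueSaw (t : TabsQ) (ht : t.saw = fun j v => (CertD11.sawRows v).getD j 0) (va : Atom → ℚ) :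
    ∀ c ∈ cellsAt CertD11.P, PX.evalQ va ((withTrueSaw t).val 11) c = PX.evalQ va (t.val 11) c :=
  evalQ_congr_of_sawRead (t := withTrueSaw t) (t' := t) cellsAt_read rfl rfl rfl
    (fun j v h => by simp only [withTrueSaw, ht]; exact (sawRows_getD_eq_card h).symm) va

/-- the same at the `(11, 13, 28)` parameters. -/
theorem evalQ_withTrueSaw13 (t : TabsQ) (ht : t.saw = fun j v => (CertD11.sawRows v).getD j 0) (va : Atom → ℚ) :
    ∀ c ∈ cellsAt CertD11CS13.P13, PX.evalQ va ((withTrueSaw t).val 11) c = PX.evalQ va (t.val 11) c :=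
  evalQ_congr_of_sawRead (t := withTrueSaw t) (t' := t) cellsAt13_read rfl rfl rfl
    (fun j v h => by simp only [withTrueSaw, ht]; exact (sawRows_getD_eq_card h).symm) va

/-- instance: the upper-endpoint record tables `CertD11.tabsHi`. -/
theorem evalQ_withTrueSaw_tabsHi (va : Atom → ℚ) :
    ∀ c ∈ cellsAt CertD11.P,
      PX.evalQ va ((withTrueSaw CertD11.tabsHi).val 11) c = PX.evalQ va (CertD11.tabsHi.val 11) c :=
  evalQ_withTrueSaw _ rfl va

/-- HEADLINE (real semantics): the cast real tables likewise. -/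
theorem eval_withTrueSaw (t : TabsQ) (ht : t.saw = fun j v => (CertD11.sawRows v).getD j 0) (va : Atom → ℝ) :
    ∀ c ∈ cellsAt CertD11.P, PX.eval va ((withTrueSaw t).cast.val 11) c = PX.eval va (t.cast.val 11) c :=
  eval_congr_of_sawRead (τ := (withTrueSaw t).cast) (τ' := t.cast) cellsAt_read rfl rfl rfl
    (fun j v h => by
      simp only [TabsQ.cast, withTrueSaw, ht]; exact_mod_cast (sawRows_getD_eq_card h).symm) va

/-! ## PART C — the `nrBAW` column: read sets at `ComputedSteps = 12` and `13`, their certification, the single residual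

The same access log (field `results.<CS>.access.nrBAW`) records the `nrBAW[j,11,v]` keys the engine reads: at `CS = 12`
`v = {0}` at `j = 2,…,12` and `v = {1}`, `{2} ≙ e₁ + e₂` at `j = 1,…,12` (35 keys); at `CS = 13` (the record variant `U13`)
additionally `(13, {1})` and `(13, {2})` (37 keys) — cell 12's open polygons sum `j ≤ ComputedSteps`.  The typed cells agree
(`cellsAt_bawRead`, `cellsAt13_bawRead`, controls).  `TrailCountTablesD11` / `TrailCountTablesD11V2` certify
`bawRows v j = #trailWordsTo 11 j x_v` for `v ∈ {v0, v1, v2}`, `j ≤ 12`; `(13, {2})` vanishes by parity; the ONE read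
entry not certified in the kernel is `nrBAW[13,11,{1}] = bawRows v1 13 = 1475645364480` (the number of 13-step trails
`0 → e₁` on `ℤ¹¹`, three engines agree; beyond the `n ≤ 10` range printed in `SRW.nb` §3).  Below, every statement at
`CS = 13` that needs it carries this equality as an explicit HYPOTHESIS `hres` — nothing is asserted about it. -/

/-- the `nrBAW` read test at `ComputedSteps = CS`: class `{0}` at `2 ≤ j ≤ 12` (cell 11: closed bubble / triangle / square,
`j ≤ Explicit`), classes `{1}`, `{2}` at `1 ≤ j ≤ CS` (cell 12: open polygons); every other key passes. -/
def bawKeyRead (CS : ℕ) : TKey → Bool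
  | .baw j v => (decide (2 ≤ j) && decide (j ≤ 12) && decide (v = .v0)) ||
      (decide (1 ≤ j) && decide (j ≤ CS) && (decide (v = .v1) || decide (v = .v2)))
  | _ => true

/-- `bawKeyRead` unfolded: the `nrBAW` key `(j, v)` is read iff `2 ≤ j ≤ 12 ∧ v = v0` or `1 ≤ j ≤ CS ∧ v ∈ {v1, v2}`. -/
theorem bawKeyRead_baw_iff (CS j : ℕ) (v : V) :
    bawKeyRead CS (.baw j v) = true ↔ (2 ≤ j ∧ j ≤ 12 ∧ v = .v0) ∨ (1 ≤ j ∧ j ≤ CS ∧ (v = .v1 ∨ v = .v2)) := by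
  simp only [bawKeyRead, Bool.or_eq_true, Bool.and_eq_true, decide_eq_true_eq]
  tauto

/-- the read keys as a list: `[2..12] × {v0} ++ [1..CS] × {v1} ++ [1..CS] × {v2}`. -/
def bawReadKeys (CS : ℕ) : List (ℕ × V) :=
  (List.range' 2 11).map (fun j => (j, V.v0)) ++ (List.range' 1 CS).map (fun j => (j, V.v1)) ++
    (List.range' 1 CS).map (fun j => (j, V.v2))

/-- At `ComputedSteps = 12` the `nrBAW` read list has `35 = 11 + 12 + 12` keys. -/
theorem length_bawReadKeys12 : (bawReadKeys 12).length = 35 := by decide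

/-- At `ComputedSteps = 13` the `nrBAW` read list has `37 = 11 + 13 + 13` keys. -/
theorem length_bawReadKeys13 : (bawReadKeys 13).length = 37 := by decide

/-- The read list `bawReadKeys CS` enumerates exactly the keys passing the read test `bawKeyRead CS`. -/
theorem mem_bawReadKeys_iff (CS j : ℕ) (v : V) : (j, v) ∈ bawReadKeys CS ↔ bawKeyRead CS (.baw j v) = true := by
  rw [bawKeyRead_baw_iff]
  simp only [bawReadKeys, List.mem_append, List.mem_map, List.mem_range'_1, Prod.mk.injEq]
  constructor
  · rintro ((⟨a, ⟨h1, h2⟩, rfl, rfl⟩ | ⟨a, ⟨h1, h2⟩, rfl, rfl⟩) | ⟨a, ⟨h1, h2⟩, rfl, rfl⟩)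
    · exact Or.inl ⟨h1, by omega, rfl⟩
    · exact Or.inr ⟨h1, by omega, Or.inl rfl⟩
    · exact Or.inr ⟨h1, by omega, Or.inr rfl⟩
  · rintro (⟨h1, h2, rfl⟩ | ⟨h1, h2, rfl | rfl⟩)
    · exact Or.inl (Or.inl ⟨j, ⟨h1, by omega⟩, rfl, rfl⟩)
    · exact Or.inl (Or.inr ⟨j, ⟨h1, by omega⟩, rfl, rfl⟩)
    · exact Or.inr ⟨j, ⟨h1, by omega⟩, rfl, rfl⟩

/-! ### the typed-cell census for `nrBAW` -/

/-- CENSUS at `(11, 12, 28)`: every `.baw j v` key any closed stage-1 cell reads passes `bawKeyRead 12`. -/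
theorem cellsAt_bawRead : (cellsAt CertD11.P).all (PXKeys.allTabs (bawKeyRead 12)) = true := by decide +kernel

/-- CENSUS at `(11, 13, 28)`: every `.baw j v` key read passes `bawKeyRead 13`. -/
theorem cellsAt13_bawRead : (cellsAt CertD11CS13.P13).all (PXKeys.allTabs (bawKeyRead 13)) = true := by decide +kernel

/-- Control: at `(11, 13, 28)` the `CS = 12` test FAILS, and it fails precisely on BOTH new keys — `(13, {1})` is read and
`(13, {2})` is read (cell 12's open polygons sum `j ≤ ComputedSteps = 13`). -/
theorem cellsAt13_bawRead_needs13 :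
    (cellsAt CertD11CS13.P13).all (PXKeys.allTabs (bawKeyRead 12)) = false ∧
    (cellsAt CertD11CS13.P13).all (PXKeys.allTabs fun k => match k with
      | .baw j v => bawKeyRead 13 (.baw j v) && !(decide (j = 13) && decide (v = .v1))
      | _ => true) = false ∧
    (cellsAt CertD11CS13.P13).all (PXKeys.allTabs fun k => match k with
      | .baw j v => bawKeyRead 13 (.baw j v) && !(decide (j = 13) && decide (v = .v2))
      | _ => true) = false := by
  refine ⟨?_, ?_, ?_⟩ <;> decide +kernel

/-- Control: the class-`{0}` range is tight below — `(1, {0})` is NOT needed but `(2, {0})` is read; and no class other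
than `{0}`, `{1}`, `{2}` is read (the test with `{2}` removed fails, the test as stated passes). -/
theorem cellsAt_bawRead_controls :
    (cellsAt CertD11.P).all (PXKeys.allTabs fun k => match k with
      | .baw j v => bawKeyRead 12 (.baw j v) && !(decide (j = 2) && decide (v = .v0))
      | _ => true) = false ∧
    (cellsAt CertD11.P).all (PXKeys.allTabs fun k => match k with
      | .baw j v => bawKeyRead 12 (.baw j v) && !decide (v = .v2)
      | _ => true) = false := by
  constructor <;> decide +kernel

/-! ### certification of the read `nrBAW` entries -/

/-- `(13, {2})`: `bawRows v2 13 = 0` IS the count (parity: no odd-length walk reaches `e₁ + e₂`). -/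
theorem bawRows_v2_getD_13 :
    (CertD11.bawRows .v2).getD 13 0 = ((trailWordsTo 11 13 (siteOfList [1, 1] 11)).card : ℚ) := by
  rw [card_trailWordsTo_d11_x11_odd 13 (by decide)]; norm_num [CertD11.bawRows]

/-- At `CS = 12` EVERY read `nrBAW` entry is the trail count (`TrailCountTablesD11`, `TrailCountTablesD11V2`). -/
theorem baw_read_certified12 {j : ℕ} {v : V} (h : bawKeyRead 12 (.baw j v) = true) :
    (CertD11.bawRows v).getD j 0 = ((trailWordsTo 11 j (siteOfList (sawProfile v) 11)).card : ℚ) := by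
  rw [bawKeyRead_baw_iff] at h
  rcases h with ⟨h2, h12, rfl⟩ | ⟨h1, h12, rfl | rfl⟩
  · exact bawRows_v0_eq_card j (by omega) h12
  · exact bawRows_v1_eq_card j h12
  · exact bawRows_v2_eq_card' j h12

/-- At `CS = 13` every read `nrBAW` entry OTHER THAN `(13, {1})` is the trail count. -/
theorem baw_read_certified13 {j : ℕ} {v : V} (h : bawKeyRead 13 (.baw j v) = true) (hne : (j, v) ≠ (13, V.v1)) :
    (CertD11.bawRows v).getD j 0 = ((trailWordsTo 11 j (siteOfList (sawProfile v) 11)).card : ℚ) := by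
  rw [bawKeyRead_baw_iff] at h
  rcases h with ⟨h2, h12, rfl⟩ | ⟨h1, h13, rfl | rfl⟩
  · exact bawRows_v0_eq_card j (by omega) h12
  · rcases Nat.lt_or_ge j 13 with hj | hj
    · exact bawRows_v1_eq_card j (by omega)
    · exact absurd (show (j, V.v1) = (13, V.v1) by rw [show j = 13 by omega]) hne
  · rcases Nat.lt_or_ge j 13 with hj | hj
    · exact bawRows_v2_eq_card' j (by omega)
    · rw [show j = 13 by omega]; exact bawRows_v2_getD_13

/-- … hence, GIVEN the residual equality for `(13, {1})`, every read entry at `CS = 13` is the trail count. -/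
theorem baw_read_certified13_of_res
    (hres : (CertD11.bawRows .v1).getD 13 0 = ((trailWordsTo 11 13 (siteOfList [1] 11)).card : ℚ))
    {j : ℕ} {v : V} (h : bawKeyRead 13 (.baw j v) = true) :
    (CertD11.bawRows v).getD j 0 = ((trailWordsTo 11 j (siteOfList (sawProfile v) 11)).card : ℚ) := by
  by_cases hne : (j, v) = (13, V.v1)
  · obtain ⟨rfl, rfl⟩ := Prod.mk.inj hne; exact hres
  · exact baw_read_certified13 h hne

/-! ### congruence and the headline for the `nrBAW` column -/

/-- two rational table records agreeing off the `nrBAW` column and on its `CS`-read set give every cell of a parameter set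
censused for `bawKeyRead CS` the same value. -/
theorem evalQ_congr_of_bawRead {P : Params} {CS : ℕ} (hP : (cellsAt P).all (PXKeys.allTabs (bawKeyRead CS)) = true)
    {t t' : TabsQ} (hI : t.I = t'.I) (hK : t.K = t'.K) (hsaw : t.saw = t'.saw)
    (hbaw : ∀ j v, bawKeyRead CS (.baw j v) = true → t.baw j v = t'.baw j v) (va : Atom → ℚ) :
    ∀ c ∈ cellsAt P, PX.evalQ va (t.val 11) c = PX.evalQ va (t'.val 11) c := by
  rw [List.all_eq_true] at hP
  have hk : ∀ k, bawKeyRead CS k = true → t.val 11 k = t'.val 11 k := by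
    intro k hk
    cases k with
    | I n l v => simp only [TabsQ.val, hI]
    | K n l v => simp only [TabsQ.val, hK]
    | saw j v => simp only [TabsQ.val, hsaw]
    | baw j v => exact hbaw j v hk
    | sawIk6 => simp only [TabsQ.val, hsaw]
    | sawIk4 => simp only [TabsQ.val, hsaw]
    | sawTwoi6 => simp only [TabsQ.val, hsaw]
  intro c hc
  exact PXKeys.evalQ_congr hk c (hP c hc)

/-- real-semantics version. -/
theorem eval_congr_of_bawRead {P : Params} {CS : ℕ} (hP : (cellsAt P).all (PXKeys.allTabs (bawKeyRead CS)) = true)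
    {τ τ' : Tabs} (hI : τ.I = τ'.I) (hK : τ.K = τ'.K) (hsaw : τ.saw = τ'.saw)
    (hbaw : ∀ j v, bawKeyRead CS (.baw j v) = true → τ.baw j v = τ'.baw j v) (va : Atom → ℝ) :
    ∀ c ∈ cellsAt P, PX.eval va (τ.val 11) c = PX.eval va (τ'.val 11) c := by
  rw [List.all_eq_true] at hP
  have hk : ∀ k, bawKeyRead CS k = true → τ.val 11 k = τ'.val 11 k := by
    intro k hk
    cases k with
    | I n l v => simp only [Tabs.val, hI]
    | K n l v => simp only [Tabs.val, hK]
    | saw j v => simp only [Tabs.val, hsaw]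
    | baw j v => exact hbaw j v hk
    | sawIk6 => simp only [Tabs.val, hsaw]
    | sawIk4 => simp only [Tabs.val, hsaw]
    | sawTwoi6 => simp only [Tabs.val, hsaw]
  intro c hc
  exact PXKeys.eval_congr hk c (hP c hc)

/-- a rational table record with its ENTIRE `nrBAW` column replaced by the true trail counts `#trailWordsTo 11 j x_v`. -/
noncomputable def withTrueBaw (t : TabsQ) : TabsQ :=
  { t with baw := fun j v => ((trailWordsTo 11 j (siteOfList (sawProfile v) 11)).card : ℚ) }

/-- HEADLINE (`CS = 12`, unconditional): for any record whose `nrBAW` column is `CertD11.bawRows` (`tabsHi`, `tabsLo`, …: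
`rfl`), substituting the TRUE trail counts for the whole column changes the value of no stage-1 cell at `(11, 12, 28)`. -/
theorem evalQ_withTrueBaw (t : TabsQ) (ht : t.baw = fun j v => (CertD11.bawRows v).getD j 0) (va : Atom → ℚ) :
    ∀ c ∈ cellsAt CertD11.P, PX.evalQ va ((withTrueBaw t).val 11) c = PX.evalQ va (t.val 11) c :=
  evalQ_congr_of_bawRead (t := withTrueBaw t) (t' := t) cellsAt_bawRead rfl rfl rfl
    (fun j v h => by simp only [withTrueBaw, ht]; exact (baw_read_certified12 h).symm) va

/-- HEADLINE (`CS = 13`, the record variant — CONDITIONAL on the single residual `hres`): substituting the true trail counts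
for the whole `nrBAW` column changes the value of no stage-1 cell at `(11, 13, 28)`, PROVIDED `nrBAW[13,11,{1}] =
1475645364480` is the number of 13-step trails `0 → e₁` on `ℤ¹¹`. -/
theorem evalQ_withTrueBaw13
    (hres : (CertD11.bawRows .v1).getD 13 0 = ((trailWordsTo 11 13 (siteOfList [1] 11)).card : ℚ))
    (t : TabsQ) (ht : t.baw = fun j v => (CertD11.bawRows v).getD j 0) (va : Atom → ℚ) :
    ∀ c ∈ cellsAt CertD11CS13.P13, PX.evalQ va ((withTrueBaw t).val 11) c = PX.evalQ va (t.val 11) c :=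
  evalQ_congr_of_bawRead (t := withTrueBaw t) (t' := t) cellsAt13_bawRead rfl rfl rfl
    (fun j v h => by simp only [withTrueBaw, ht]; exact (baw_read_certified13_of_res hres h).symm) va

/-- instance: `CertD11.tabsHi` at `(11, 12, 28)`, both walk-count columns replaced by the true counts at once. -/
theorem evalQ_withTrueWalkCounts_tabsHi (va : Atom → ℚ) :
    ∀ c ∈ cellsAt CertD11.P,
      PX.evalQ va ((withTrueBaw (withTrueSaw CertD11.tabsHi)).val 11) c = PX.evalQ va (CertD11.tabsHi.val 11) c := by
  intro c hc
  rw [evalQ_withTrueBaw (withTrueSaw CertD11.tabsHi) rfl va c hc]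
  exact evalQ_withTrueSaw _ rfl va c hc

/-- real semantics, `CS = 12`. -/
theorem eval_withTrueBaw (t : TabsQ) (ht : t.baw = fun j v => (CertD11.bawRows v).getD j 0) (va : Atom → ℝ) :
    ∀ c ∈ cellsAt CertD11.P, PX.eval va ((withTrueBaw t).cast.val 11) c = PX.eval va (t.cast.val 11) c :=
  eval_congr_of_bawRead (τ := (withTrueBaw t).cast) (τ' := t.cast) cellsAt_bawRead rfl rfl rfl
    (fun j v h => by
      simp only [TabsQ.cast, withTrueBaw, ht]; exact_mod_cast (baw_read_certified12 h).symm) va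

/-- the residual entry, read off the table. -/
theorem bawRows_v1_getD_13 : (CertD11.bawRows .v1).getD 13 0 = 1475645364480 := by norm_num [CertD11.bawRows]

/-- ONE-SIDED FORM of the residual (what validity actually needs).  With nonnegative atoms and well-formed tables, if the
true number of 13-step trails `0 → e₁` on `ℤ¹¹` is AT MOST the recorded entry `1475645364480`, then every cell at
`(11, 13, 28)` evaluated on the TRUE `nrBAW` column is at most its value on the recorded column (cells are positive
expressions — `PXKeys.eval_mono_tabs_on`): the recorded stage-1 values remain upper bounds of the true-count values. -/
theorem eval_withTrueBaw13_le
    (hle : ((trailWordsTo 11 13 (siteOfList [1] 11)).card : ℚ) ≤ 1475645364480)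
    (t : TabsQ) (ht : t.baw = fun j v => (CertD11.bawRows v).getD j 0) (hwf : t.cast.WF 11)
    (va : Atom → ℝ) (hva : ∀ a, 0 ≤ va a) :
    ∀ c ∈ cellsAt CertD11CS13.P13, PX.eval va ((withTrueBaw t).cast.val 11) c ≤ PX.eval va (t.cast.val 11) c := by
  have hall := cellsAt13_bawRead
  rw [List.all_eq_true] at hall
  have hwf' : (withTrueBaw t).cast.WF 11 :=
    { I := hwf.I, K := hwf.K, saw := hwf.saw,
      baw := fun j v => by simp only [TabsQ.cast, withTrueBaw]; exact_mod_cast Nat.zero_le _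
      sawIk6 := hwf.sawIk6, sawIk4 := hwf.sawIk4, sawTwoi6 := hwf.sawTwoi6 }
  have hle' : ∀ k, bawKeyRead 13 k = true → (withTrueBaw t).cast.val 11 k ≤ t.cast.val 11 k := by
    intro k hk
    cases k with
    | baw j v =>
      simp only [TabsQ.cast, Tabs.val, withTrueBaw, ht]
      by_cases hne : (j, v) = (13, V.v1)
      · obtain ⟨rfl, rfl⟩ := Prod.mk.inj hne; rw [bawRows_v1_getD_13]; exact_mod_cast hle
      · exact_mod_cast (baw_read_certified13 hk hne).symm.le
    | _ => exact le_rfl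
  intro c hc
  exact PXKeys.eval_mono_tabs_on hva hwf'.val_nonneg hwf.val_nonneg hle' c (hall c hc)

end Summit.CriticalPhenomena.LaceExpansionHighD
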